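import Summits.Langlands.Langlands.Theorems.LevelOneDyadicPotentialKernels

/-!
# Level-one dyadic companions, part 9: the minimal Lie-irreducible counterexample is ⊗-PRIMITIVE and FIELD-PRIMITIVE —
# Kronecker and twisted-base-change cells of the companion box settled by a lexicographic induction on (dimension, absolute degree)

decomp-langlands lens-4 (minimal counterexample / extremal reduction) g13 node `PrimitiveCompanionCore`
(HOME/nodes/lens-4-g13-PrimitiveCompanionCore.lean; v2 = crit-1 CRITIC-LEDGER row 156 fix F1 applied: the base-change dial is
TWISTED by a level-one character of Γ_K and guarded to n ≥ 2 — closed under the companion box's own symmetry ρ ↦ ρ ⊗ χ; TP / FRAME /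
Assembly unchanged).  Tree-landable twin shape `Theorems/LevelOneDyadicPrimitive.lean`: imports part 7b
(`LevelOneDyadicPotentialKernels`, landed) only; no route-file import; no new objects beyond `Prop`s; 0 sorry; axioms standard.

Tree twin, part 9a of the lineage (census-1 g16): vocabulary, pieces TP / FD (twisted, v2) / PR′, bridges, kernels I–III (necessity, exactness,
closes).  Part 9b `LevelOneDyadicPrimitiveProofs` proves TP and FD outright and records R ⟺ PR′.  The node's full header (thesis, the
extremal-reduction narrative, the row-156 closure check) is kept verbatim in HOME/nodes/lens-4-g13-PrimitiveCompanionCore.full.lean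
(sha256 b6af5afdab67…); only the sources paragraph is reproduced here.

Sources: J.-P. Serre, *Abelian ℓ-adic representations and elliptic curves* (1968) I-11–I-12 (compatible systems are closed under ⊗, ⊕,
restriction); P. Deligne, Weil II (1980) Conj. 1.2.10 and L. Lafforgue, Invent. Math. 147 (2002) Thm VII.6, V. Drinfeld, Mosc. Math. J. 12
(2012) [arXiv:1007.4004], T. Abe – H. Esnault, Ann. Sci. ÉNS 52 (2019) [arXiv:1607.06207] (the function-field sibling: companions exist);
M. Larsen – R. Pink, Invent. Math. 102 (1990) 377–398 and S. Patrikis, *Variations on a theorem of Tate*, Mem. AMS 258 (2019) [arXiv:1207.6724]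
(tensor-decomposition / lifting of geometric Galois representations; primitive Lie types); S. Patrikis – R. Taylor, Compos. Math. 151 (2015)
[arXiv:1307.1640] (irreducibility and companions in compatible systems); T. Barnet-Lamb, T. Gee, D. Geraghty, R. Taylor, Ann. of Math. 179 (2014)
Thm 5.5.1 [BLGGT14] (polarisable regular ⇒ compatible systems: PR's print island); D. Ramakrishnan, Ann. of Math. 152 (2000) and H. Kim –
F. Shahidi, Ann. of Math. 155 (2002) (the automorphy-side ⊠ ceiling GL₂×GL₂, GL₂×GL₃); the lineage sources of parts 5–7b.  No new axioms.
-/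

set_option linter.dupNamespace false

namespace Summit.Langlands.Langlands.Theorems.LevelOneDyadic.Primitive

open scoped NumberField
open Filter IsDedekindDomain
open Literature.NumberTheory.GaloisRepresentations Literature.NumberTheory.Automorphic Literature.NumberTheory.PAdicHodge
open Summit.Langlands.Langlands.Theorems.LevelOneDyadic (IsPinnedGeometric IsCrystallineAbove IsUnramifiedAwayFrom
  CompanionMatch DyadicContinuousCompanion DyadicCompanionExistence DyadicDeRhamRigidity DyadicIrreducibilityTransfer
  DyadicLevelTransfer dyadicContinuousCompanion_of_langlands dyadicCompanionExistence_of_TG)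
open Summit.Langlands.Langlands.Theorems.LevelOneDyadic.Clifford (HasDyadicCompanion DimSlice IsLieIrreducible
  LieIrreducibleCompanion CliffordCompanionStep lieIrreducibleCompanion_iff dyadicContinuousCompanion_of_pieces
  lieIrreducibleCompanion_of_T lieIrreducibleCompanion_of_E lieIrreducibleCompanion_of_langlands langlands_of_pieces₉)
open Summit.Langlands.Langlands.Theorems.LevelOneDyadic.TensorCore (ArtinTensorCore CliffordTateShapes
  dyadicCompanionExistence_of_resplit4β langlands_of_pieces₁₀β)
open Summit.Langlands.Langlands.Theorems.LevelOneDyadic.Potential (IsLevelOne PotentialCompanions BrauerTaylorDescent LevelOneHeredity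
  potentialCompanions_of_R lieIrreducibleCompanion_of_pieces')

/-! ## Vocabulary (helper predicates; the filed texts inline them verbatim — bridges are `Iff.rfl`) -/

section Vocabulary

variable {K : Type} [Field K] [NumberField K] {ℓ : ℕ} [Fact ℓ.Prime] {n : ℕ}

/-- `σ` is a MEMBER OF R'S BOX: irreducible, Lie-irreducible (irreducible on every Γ_L), pinned-geometric, crystalline above ℓ and
unramified away from ℓ (level one). -/
def IsLieLevelOne (σ : FramedGaloisRep K (PadicAlgCl ℓ) n) : Prop :=
  σ.toGaloisRep.IsIrreducible ∧ IsLieIrreducible σ ∧ IsPinnedGeometric σ ∧ IsCrystallineAbove σ ∧ IsUnramifiedAwayFrom σ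

/-- KRONECKER DIAL: `charpoly ρ(g) = charpoly (σ₁(g) ⊗ₖ σ₂(g))` for all `g ∈ Γ_K`, with `σ₁ : Γ_K → GL_a(ℚ̄_ℓ)`, `σ₂ : Γ_K → GL_b(ℚ̄_ℓ)`
members of R's box (irreducible, Lie-irreducible, level one), `a, b ≥ 2`, `n = ab` (for these ρ: ρ ≅ σ₁ ⊗ σ₂, Brauer–Nesbitt — not needed). -/
def IsKroneckerOfLevelOne (ρ : FramedGaloisRep K (PadicAlgCl ℓ) n) : Prop :=
  ∃ (a b : ℕ) (σ₁ : FramedGaloisRep K (PadicAlgCl ℓ) a) (σ₂ : FramedGaloisRep K (PadicAlgCl ℓ) b),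
    2 ≤ a ∧ 2 ≤ b ∧ n = a * b ∧ IsLieLevelOne σ₁ ∧ IsLieLevelOne σ₂ ∧
      ∀ g : Field.absoluteGaloisGroup K,
        FramedRep.charpoly ρ g =
          (Matrix.kroneckerMap (· * ·)
            ((σ₁ g : GL (Fin a) (PadicAlgCl ℓ)) : Matrix (Fin a) (Fin a) (PadicAlgCl ℓ))
            ((σ₂ g : GL (Fin b) (PadicAlgCl ℓ)) : Matrix (Fin b) (Fin b) (PadicAlgCl ℓ))).charpoly

/-- TWISTED BASE-CHANGE DIAL (v2, crit-1 row 156 F1): `n ≥ 2` and `charpoly ρ(g) = charpoly ((ρ₀|Γ_K)(g) ⊗ₖ χ(g))` for all `g ∈ Γ_K`, with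
`ρ₀ : Γ_{K₀} → GL_n(ℚ̄_ℓ)` a member of R's box over a subfield `K₀ ⊆ K` of STRICTLY SMALLER absolute degree and `χ : Γ_K → GL_1(ℚ̄_ℓ)` a level-one
character (an `n = 1` member of R's box over K) — for these ρ: ρ ≅ ρ₀|Γ_K ⊗ χ (Brauer–Nesbitt, not needed).  CLOSED under the box symmetry ρ ↦ ρ ⊗ χ
((ρ₀|K ⊗ χ₁) ⊗ χ₂ = ρ₀|K ⊗ (χ₁χ₂), χ₁χ₂ again level one); with the Kronecker dial saturated under every word in {restrict, ⊗ box-character,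
⊗ box-member}.  The guard `2 ≤ n` keeps the cell's appeal to the slice (1, [K:ℚ]) strictly below (n, [K:ℚ]) (at n = 1 the companion of χ would be
the companion of ρ itself). -/
def IsTwistedBaseChangedOfLevelOne (ρ : FramedGaloisRep K (PadicAlgCl ℓ) n) : Prop :=
  2 ≤ n ∧ ∃ χ : FramedGaloisRep K (PadicAlgCl ℓ) 1, IsLieLevelOne χ ∧
    ∃ (K₀ : Type) (_ : Field K₀) (_ : NumberField K₀) (_ : Algebra K₀ K) (ρ₀ : FramedGaloisRep K₀ (PadicAlgCl ℓ) n),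
      Module.finrank ℚ K₀ < Module.finrank ℚ K ∧ IsLieLevelOne ρ₀ ∧
        ∀ g : Field.absoluteGaloisGroup K,
          FramedRep.charpoly ρ g =
            (Matrix.kroneckerMap (· * ·)
              (((ρ₀.restrictField K) g : GL (Fin n) (PadicAlgCl ℓ)) : Matrix (Fin n) (Fin n) (PadicAlgCl ℓ))
              ((χ g : GL (Fin 1) (PadicAlgCl ℓ)) : Matrix (Fin 1) (Fin 1) (PadicAlgCl ℓ))).charpoly

end Vocabulary

section Slices

/-- The `(d, n)`-SLICE of R: R for the members of dimension `n` over number fields of absolute degree `[K:ℚ] = d`. -/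
def LieSlice (d n : ℕ) : Prop :=
  ∀ (K : Type) [Field K] [NumberField K], Module.finrank ℚ K = d → 0 < n → ∀ (ℓ : ℕ) [Fact ℓ.Prime], ℓ ≠ 2 →
    ∀ (ι : PadicAlgCl ℓ ≃+* ℂ) (σ : FramedGaloisRep K (PadicAlgCl ℓ) n), σ.toGaloisRep.IsIrreducible → IsLieIrreducible σ →
      IsPinnedGeometric σ → IsCrystallineAbove σ → IsUnramifiedAwayFrom σ → ∀ (ι₂ : PadicAlgCl 2 ≃+* ℂ), HasDyadicCompanion ι ι₂ σ

/-- The INDUCTION HYPOTHESIS carried by every cell: R holds on every slice `(n′, d′)` LEXICOGRAPHICALLY BELOW `(n, [K:ℚ])`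
(smaller dimension, any field; or the same dimension over fields of smaller absolute degree). -/
def LieSliceBelow (K : Type) [Field K] [NumberField K] (n : ℕ) : Prop :=
  ∀ (d' n' : ℕ), (n' < n ∨ (n' = n ∧ d' < Module.finrank ℚ K)) → LieSlice d' n'

end Slices

/-! ## The pieces — ONE-LINE self-contained Props over tree declarations (= the texts of `texts.json`) -/

section Pieces

/-- [support-grade crux · TP · NEW · WEAKER than R (`kroneckerCompanionCell_of_R`) · ATTACKABLE NOW (provable outright: companions of the
two factors by the carried IH at dimensions a, b < n, then the Kronecker product of the companions; Frobenius root multisets multiply)]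
KRONECKER CELL OF THE COMPANION BOX: for ρ as in R whose characteristic polynomials are those of a Kronecker product σ₁ ⊗ σ₂ of two
irreducible, Lie-irreducible, level-one representations of dimensions a, b ≥ 2 (ab = n), GIVEN R on every slice lexicographically below
(n, [K:ℚ]), ρ has an a.e.-unramified 2-adic companion for every ι₂. -/
def KroneckerCompanionCell : Prop :=
  ∀ (K : Type) [Field K] [NumberField K] (n : ℕ), 0 < n → ∀ (ℓ : ℕ) [Fact ℓ.Prime], ℓ ≠ 2 → ∀ (ι : PadicAlgCl ℓ ≃+* ℂ) (ρ : Literature.NumberTheory.GaloisRepresentations.FramedGaloisRep K (PadicAlgCl ℓ) n), ρ.toGaloisRep.IsIrreducible → (∀ (L : Type) [Field L] [NumberField L] [Algebra K L], (ρ.restrictField L).toGaloisRep.IsIrreducible) → ((∀ᶠ v : IsDedekindDomain.HeightOneSpectrum (NumberField.RingOfIntegers K) in cofinite, ρ.IsUnramifiedAt v) ∧ ∀ (v : IsDedekindDomain.HeightOneSpectrum (NumberField.RingOfIntegers K)) (hv : ((ℓ : ℕ) : NumberField.RingOfIntegers K) ∈ v.asIdeal), (Literature.NumberTheory.PAdicHodge.fontainePstAdicCompletion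 v ℓ hv).IsDeRhamFramed (ρ.toLocal v)) → (∀ (v : IsDedekindDomain.HeightOneSpectrum (NumberField.RingOfIntegers K)) (hv : ((ℓ : ℕ) : NumberField.RingOfIntegers K) ∈ v.asIdeal), (Literature.NumberTheory.PAdicHodge.fontainePstAdicCompletion v ℓ hv).IsCrystallineFramed (ρ.toLocal v)) → (∀ w : IsDedekindDomain.HeightOneSpectrum (NumberField.RingOfIntegers K), ((ℓ : ℕ) : NumberField.RingOfIntegers K) ∉ w.asIdeal → ρ.IsUnramifiedAt w) → (∀ (d' n' : ℕ), (n' < n ∨ (n' = n ∧ d' < Module.finrank ℚ K)) → ∀ (K' : Type) [Field K'] [NumberField K'], Module.finrank ℚ K' = d' → 0 < n' → ∀ (ℓ' : ℕ) [Fact ℓ'.Prime], ℓ' ≠ 2 → ∀ (ι' : PadicAlgCl ℓ' ≃+* ℂ) (σ : Literature.NumberTheory.GaloisRepresentations.FramedGaloisRep K' (PadicAlgCl ℓ') n'), σ.toGaloisRep.IsIrreducible → (∀ (L : Type) [Field L] [NumberField L] [Algebra K' L], (σ.restrictField L).toGaloisRep.IsIrreducible) → ((∀ᶠ v : IsDedekindDomain.HeightOneSpectrum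 (NumberField.RingOfIntegers K') in cofinite, σ.IsUnramifiedAt v) ∧ ∀ (v : IsDedekindDomain.HeightOneSpectrum (NumberField.RingOfIntegers K')) (hv : ((ℓ' : ℕ) : NumberField.RingOfIntegers K') ∈ v.asIdeal), (Literature.NumberTheory.PAdicHodge.fontainePstAdicCompletion v ℓ' hv).IsDeRhamFramed (σ.toLocal v)) → (∀ (v : IsDedekindDomain.HeightOneSpectrum (NumberField.RingOfIntegers K')) (hv : ((ℓ' : ℕ) : NumberField.RingOfIntegers K') ∈ v.asIdeal), (Literature.NumberTheory.PAdicHodge.fontainePstAdicCompletion v ℓ' hv).IsCrystallineFramed (σ.toLocal v)) → (∀ w : IsDedekindDomain.HeightOneSpectrum (NumberField.RingOfIntegers K'), ((ℓ' : ℕ) : NumberField.RingOfIntegers K') ∉ w.asIdeal → σ.IsUnramifiedAt w) → ∀ (ι₂' : PadicAlgCl 2 ≃+* ℂ), ∃ σ₂ : Literature.NumberTheory.GaloisRepresentations.FramedGaloisRep K' (PadicAlgCl 2) n', (∀ᶠ v : IsDedekindDomain.HeightOneSpectrum (NumberField.RingOfIntegers K') in cofinite, σ₂.IsUnramifiedAt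 v) ∧ (∀ᶠ v : IsDedekindDomain.HeightOneSpectrum (NumberField.RingOfIntegers K') in cofinite, ∃ α : Multiset ℂ, σ.HasFrobCharpolyAt v (Literature.NumberTheory.Automorphic.arithFrobPolyOfSatake ι' v.residueCard 1 α) ∧ σ₂.HasFrobCharpolyAt v (Literature.NumberTheory.Automorphic.arithFrobPolyOfSatake ι₂' v.residueCard 1 α))) → (∃ (a b : ℕ) (σ₁ : Literature.NumberTheory.GaloisRepresentations.FramedGaloisRep K (PadicAlgCl ℓ) a) (σ₂ : Literature.NumberTheory.GaloisRepresentations.FramedGaloisRep K (PadicAlgCl ℓ) b), 2 ≤ a ∧ 2 ≤ b ∧ n = a * b ∧ (σ₁.toGaloisRep.IsIrreducible ∧ (∀ (L : Type) [Field L] [NumberField L] [Algebra K L], (σ₁.restrictField L).toGaloisRep.IsIrreducible) ∧ ((∀ᶠ v : IsDedekindDomain.HeightOneSpectrum (NumberField.RingOfIntegers K) in cofinite, σ₁.IsUnramifiedAt v) ∧ ∀ (v : IsDedekindDomain.HeightOneSpectrum (NumberField.RingOfIntegers K)) (hv : ((ℓ : ℕ) : NumberField.RingOfIntegers K) ∈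 v.asIdeal), (Literature.NumberTheory.PAdicHodge.fontainePstAdicCompletion v ℓ hv).IsDeRhamFramed (σ₁.toLocal v)) ∧ (∀ (v : IsDedekindDomain.HeightOneSpectrum (NumberField.RingOfIntegers K)) (hv : ((ℓ : ℕ) : NumberField.RingOfIntegers K) ∈ v.asIdeal), (Literature.NumberTheory.PAdicHodge.fontainePstAdicCompletion v ℓ hv).IsCrystallineFramed (σ₁.toLocal v)) ∧ (∀ w : IsDedekindDomain.HeightOneSpectrum (NumberField.RingOfIntegers K), ((ℓ : ℕ) : NumberField.RingOfIntegers K) ∉ w.asIdeal → σ₁.IsUnramifiedAt w)) ∧ (σ₂.toGaloisRep.IsIrreducible ∧ (∀ (L : Type) [Field L] [NumberField L] [Algebra K L], (σ₂.restrictField L).toGaloisRep.IsIrreducible) ∧ ((∀ᶠ v : IsDedekindDomain.HeightOneSpectrum (NumberField.RingOfIntegers K) in cofinite, σ₂.IsUnramifiedAt v) ∧ ∀ (v : IsDedekindDomain.HeightOneSpectrum (NumberField.RingOfIntegers K)) (hv : ((ℓ : ℕ) : NumberField.RingOfIntegers K) ∈ v.asIdeal), (Literature.NumberTheory.PAdicHodge.fontainePstAdicCompletion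 v ℓ hv).IsDeRhamFramed (σ₂.toLocal v)) ∧ (∀ (v : IsDedekindDomain.HeightOneSpectrum (NumberField.RingOfIntegers K)) (hv : ((ℓ : ℕ) : NumberField.RingOfIntegers K) ∈ v.asIdeal), (Literature.NumberTheory.PAdicHodge.fontainePstAdicCompletion v ℓ hv).IsCrystallineFramed (σ₂.toLocal v)) ∧ (∀ w : IsDedekindDomain.HeightOneSpectrum (NumberField.RingOfIntegers K), ((ℓ : ℕ) : NumberField.RingOfIntegers K) ∉ w.asIdeal → σ₂.IsUnramifiedAt w)) ∧ ∀ g : Field.absoluteGaloisGroup K, Literature.NumberTheory.GaloisRepresentations.FramedRep.charpoly ρ g = (Matrix.kroneckerMap (· * ·) ((σ₁ g : GL (Fin a) (PadicAlgCl ℓ)) : Matrix (Fin a) (Fin a) (PadicAlgCl ℓ)) ((σ₂ g : GL (Fin b) (PadicAlgCl ℓ)) : Matrix (Fin b) (Fin b) (PadicAlgCl ℓ))).charpoly) → ∀ (ι₂ : PadicAlgCl 2 ≃+* ℂ), ∃ ρ₂ : Literature.NumberTheory.GaloisRepresentations.FramedGaloisRep K (PadicAlgCl 2) n, (∀ᶠ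 v : IsDedekindDomain.HeightOneSpectrum (NumberField.RingOfIntegers K) in cofinite, ρ₂.IsUnramifiedAt v) ∧ (∀ᶠ v : IsDedekindDomain.HeightOneSpectrum (NumberField.RingOfIntegers K) in cofinite, ∃ α : Multiset ℂ, ρ.HasFrobCharpolyAt v (Literature.NumberTheory.Automorphic.arithFrobPolyOfSatake ι v.residueCard 1 α) ∧ ρ₂.HasFrobCharpolyAt v (Literature.NumberTheory.Automorphic.arithFrobPolyOfSatake ι₂ v.residueCard 1 α))

/-- [support-grade crux · FD · NEW · WEAKER than R (`baseChangedCompanionCell_of_R`) · ATTACKABLE NOW (provable outright: restrict the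
IH-companion of ρ₀ along K₀ ⊆ K and twist by the IH-companion of χ (slice (1,[K:ℚ]), n ≥ 2); `hasFrobCharpolyAt_restrictField` on both
sides, α ↦ α^f · β) · v2: TWISTED dial, crit-1 row 156 F1]
TWISTED BASE-CHANGE CELL OF THE COMPANION BOX: for ρ as in R, n ≥ 2, whose characteristic polynomials on Γ_K are those of ρ₀|Γ_K ⊗ χ for an
irreducible, Lie-irreducible, level-one ρ₀ over a subfield K₀ ⊆ K with [K₀:ℚ] < [K:ℚ] and a level-one character χ of Γ_K, GIVEN R on every
slice lexicographically below (n, [K:ℚ]), ρ has an a.e.-unramified 2-adic companion for every ι₂. -/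
def BaseChangedCompanionCell : Prop :=
  ∀ (K : Type) [Field K] [NumberField K] (n : ℕ), 0 < n → ∀ (ℓ : ℕ) [Fact ℓ.Prime], ℓ ≠ 2 → ∀ (ι : PadicAlgCl ℓ ≃+* ℂ) (ρ : Literature.NumberTheory.GaloisRepresentations.FramedGaloisRep K (PadicAlgCl ℓ) n), ρ.toGaloisRep.IsIrreducible → (∀ (L : Type) [Field L] [NumberField L] [Algebra K L], (ρ.restrictField L).toGaloisRep.IsIrreducible) → ((∀ᶠ v : IsDedekindDomain.HeightOneSpectrum (NumberField.RingOfIntegers K) in cofinite, ρ.IsUnramifiedAt v) ∧ ∀ (v : IsDedekindDomain.HeightOneSpectrum (NumberField.RingOfIntegers K)) (hv : ((ℓ : ℕ) : NumberField.RingOfIntegers K) ∈ v.asIdeal), (Literature.NumberTheory.PAdicHodge.fontainePstAdicCompletion v ℓ hv).IsDeRhamFramed (ρ.toLocal v)) → (∀ (v : IsDedekindDomain.HeightOneSpectrum (NumberField.RingOfIntegers K)) (hv : ((ℓ : ℕ) : NumberField.RingOfIntegers K) ∈ v.asIdeal), (Literature.NumberTheory.PAdicHodge.fontainePstAdicCompletion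 v ℓ hv).IsCrystallineFramed (ρ.toLocal v)) → (∀ w : IsDedekindDomain.HeightOneSpectrum (NumberField.RingOfIntegers K), ((ℓ : ℕ) : NumberField.RingOfIntegers K) ∉ w.asIdeal → ρ.IsUnramifiedAt w) → (∀ (d' n' : ℕ), (n' < n ∨ (n' = n ∧ d' < Module.finrank ℚ K)) → ∀ (K' : Type) [Field K'] [NumberField K'], Module.finrank ℚ K' = d' → 0 < n' → ∀ (ℓ' : ℕ) [Fact ℓ'.Prime], ℓ' ≠ 2 → ∀ (ι' : PadicAlgCl ℓ' ≃+* ℂ) (σ : Literature.NumberTheory.GaloisRepresentations.FramedGaloisRep K' (PadicAlgCl ℓ') n'), σ.toGaloisRep.IsIrreducible → (∀ (L : Type) [Field L] [NumberField L] [Algebra K' L], (σ.restrictField L).toGaloisRep.IsIrreducible) → ((∀ᶠ v : IsDedekindDomain.HeightOneSpectrum (NumberField.RingOfIntegers K') in cofinite, σ.IsUnramifiedAt v) ∧ ∀ (v : IsDedekindDomain.HeightOneSpectrum (NumberField.RingOfIntegers K')) (hv : ((ℓ' : ℕ) : NumberField.RingOfIntegers K') ∈ v.asIdeal), (Literature.NumberTheory.PAdicHodge.fontainePstAdicCompletion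 v ℓ' hv).IsDeRhamFramed (σ.toLocal v)) → (∀ (v : IsDedekindDomain.HeightOneSpectrum (NumberField.RingOfIntegers K')) (hv : ((ℓ' : ℕ) : NumberField.RingOfIntegers K') ∈ v.asIdeal), (Literature.NumberTheory.PAdicHodge.fontainePstAdicCompletion v ℓ' hv).IsCrystallineFramed (σ.toLocal v)) → (∀ w : IsDedekindDomain.HeightOneSpectrum (NumberField.RingOfIntegers K'), ((ℓ' : ℕ) : NumberField.RingOfIntegers K') ∉ w.asIdeal → σ.IsUnramifiedAt w) → ∀ (ι₂' : PadicAlgCl 2 ≃+* ℂ), ∃ σ₂ : Literature.NumberTheory.GaloisRepresentations.FramedGaloisRep K' (PadicAlgCl 2) n', (∀ᶠ v : IsDedekindDomain.HeightOneSpectrum (NumberField.RingOfIntegers K') in cofinite, σ₂.IsUnramifiedAt v) ∧ (∀ᶠ v : IsDedekindDomain.HeightOneSpectrum (NumberField.RingOfIntegers K') in cofinite, ∃ α : Multiset ℂ, σ.HasFrobCharpolyAt v (Literature.NumberTheory.Automorphic.arithFrobPolyOfSatake ι' v.residueCard 1 α) ∧ σ₂.HasFrobCharpolyAt v (Literature.NumberTheory.Automorphic.arithFrobPolyOfSatake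 ι₂' v.residueCard 1 α))) → (2 ≤ n ∧ ∃ χ : Literature.NumberTheory.GaloisRepresentations.FramedGaloisRep K (PadicAlgCl ℓ) 1, (χ.toGaloisRep.IsIrreducible ∧ (∀ (L : Type) [Field L] [NumberField L] [Algebra K L], (χ.restrictField L).toGaloisRep.IsIrreducible) ∧ ((∀ᶠ v : IsDedekindDomain.HeightOneSpectrum (NumberField.RingOfIntegers K) in cofinite, χ.IsUnramifiedAt v) ∧ ∀ (v : IsDedekindDomain.HeightOneSpectrum (NumberField.RingOfIntegers K)) (hv : ((ℓ : ℕ) : NumberField.RingOfIntegers K) ∈ v.asIdeal), (Literature.NumberTheory.PAdicHodge.fontainePstAdicCompletion v ℓ hv).IsDeRhamFramed (χ.toLocal v)) ∧ (∀ (v : IsDedekindDomain.HeightOneSpectrum (NumberField.RingOfIntegers K)) (hv : ((ℓ : ℕ) : NumberField.RingOfIntegers K) ∈ v.asIdeal), (Literature.NumberTheory.PAdicHodge.fontainePstAdicCompletion v ℓ hv).IsCrystallineFramed (χ.toLocal v)) ∧ (∀ w : IsDedekindDomain.HeightOneSpectrum (NumberField.RingOfIntegers K), ((ℓ : ℕ)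 : NumberField.RingOfIntegers K) ∉ w.asIdeal → χ.IsUnramifiedAt w)) ∧ ∃ (K₀ : Type) (_ : Field K₀) (_ : NumberField K₀) (_ : Algebra K₀ K) (ρ₀ : Literature.NumberTheory.GaloisRepresentations.FramedGaloisRep K₀ (PadicAlgCl ℓ) n), Module.finrank ℚ K₀ < Module.finrank ℚ K ∧ (ρ₀.toGaloisRep.IsIrreducible ∧ (∀ (L : Type) [Field L] [NumberField L] [Algebra K₀ L], (ρ₀.restrictField L).toGaloisRep.IsIrreducible) ∧ ((∀ᶠ v : IsDedekindDomain.HeightOneSpectrum (NumberField.RingOfIntegers K₀) in cofinite, ρ₀.IsUnramifiedAt v) ∧ ∀ (v : IsDedekindDomain.HeightOneSpectrum (NumberField.RingOfIntegers K₀)) (hv : ((ℓ : ℕ) : NumberField.RingOfIntegers K₀) ∈ v.asIdeal), (Literature.NumberTheory.PAdicHodge.fontainePstAdicCompletion v ℓ hv).IsDeRhamFramed (ρ₀.toLocal v)) ∧ (∀ (v : IsDedekindDomain.HeightOneSpectrum (NumberField.RingOfIntegers K₀)) (hv : ((ℓ : ℕ) : NumberField.RingOfIntegers K₀) ∈ v.asIdeal),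 (Literature.NumberTheory.PAdicHodge.fontainePstAdicCompletion v ℓ hv).IsCrystallineFramed (ρ₀.toLocal v)) ∧ (∀ w : IsDedekindDomain.HeightOneSpectrum (NumberField.RingOfIntegers K₀), ((ℓ : ℕ) : NumberField.RingOfIntegers K₀) ∉ w.asIdeal → ρ₀.IsUnramifiedAt w)) ∧ ∀ g : Field.absoluteGaloisGroup K, Literature.NumberTheory.GaloisRepresentations.FramedRep.charpoly ρ g = (Matrix.kroneckerMap (· * ·) (((ρ₀.restrictField K) g : GL (Fin n) (PadicAlgCl ℓ)) : Matrix (Fin n) (Fin n) (PadicAlgCl ℓ)) ((χ g : GL (Fin 1) (PadicAlgCl ℓ)) : Matrix (Fin 1) (Fin 1) (PadicAlgCl ℓ))).charpoly) → ∀ (ι₂ : PadicAlgCl 2 ≃+* ℂ), ∃ ρ₂ : Literature.NumberTheory.GaloisRepresentations.FramedGaloisRep K (PadicAlgCl 2) n, (∀ᶠ v : IsDedekindDomain.HeightOneSpectrum (NumberField.RingOfIntegers K) in cofinite, ρ₂.IsUnramifiedAt v) ∧ (∀ᶠ v : IsDedekindDomain.HeightOneSpectrum (NumberField.RingOfIntegers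 K) in cofinite, ∃ α : Multiset ℂ, ρ.HasFrobCharpolyAt v (Literature.NumberTheory.Automorphic.arithFrobPolyOfSatake ι v.residueCard 1 α) ∧ ρ₂.HasFrobCharpolyAt v (Literature.NumberTheory.Automorphic.arithFrobPolyOfSatake ι₂ v.residueCard 1 α))

/-- [crux · PR · THE NEW DECLARED RESIDUAL · WEAKER than R (`primitiveCompanionCore_of_R`) · IDEA-NEEDED (dark core: ⊗-primitive,
field-primitive up to level-one twist, Lie-irreducible level-one ρ without polarisation); print islands inside (regular polarisable over
CM/TR: BLGGT; n = 1: class field theory) booked, not excised · v2: ¬(TWISTED base-change dial), crit-1 row 156 F1]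
PRIMITIVE CORE OF THE COMPANION BOX: for ρ as in R that is NEITHER charpoly-Kronecker of two Lie-irreducible level-one factors of
dimensions ≥ 2 NOR (n ≥ 2 and) charpoly-equal to ρ₀|Γ_K ⊗ χ for a Lie-irreducible level-one ρ₀ over a subfield of smaller absolute degree
and a level-one character χ of Γ_K, GIVEN R on every slice lexicographically below (n, [K:ℚ]), ρ has an a.e.-unramified 2-adic companion for
every ι₂. -/
def PrimitiveCompanionCore : Prop :=
  ∀ (K : Type) [Field K] [NumberField K] (n : ℕ), 0 < n → ∀ (ℓ : ℕ) [Fact ℓ.Prime], ℓ ≠ 2 → ∀ (ι : PadicAlgCl ℓ ≃+* ℂ) (ρ : Literature.NumberTheory.GaloisRepresentations.FramedGaloisRep K (PadicAlgCl ℓ) n), ρ.toGaloisRep.IsIrreducible → (∀ (L : Type) [Field L] [NumberField L] [Algebra K L], (ρ.restrictField L).toGaloisRep.IsIrreducible) → ((∀ᶠ v : IsDedekindDomain.HeightOneSpectrum (NumberField.RingOfIntegers K) in cofinite, ρ.IsUnramifiedAt v) ∧ ∀ (v : IsDedekindDomain.HeightOneSpectrum (NumberField.RingOfIntegers K)) (hv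 : ((ℓ : ℕ) : NumberField.RingOfIntegers K) ∈ v.asIdeal), (Literature.NumberTheory.PAdicHodge.fontainePstAdicCompletion v ℓ hv).IsDeRhamFramed (ρ.toLocal v)) → (∀ (v : IsDedekindDomain.HeightOneSpectrum (NumberField.RingOfIntegers K)) (hv : ((ℓ : ℕ) : NumberField.RingOfIntegers K) ∈ v.asIdeal), (Literature.NumberTheory.PAdicHodge.fontainePstAdicCompletion v ℓ hv).IsCrystallineFramed (ρ.toLocal v)) → (∀ w : IsDedekindDomain.HeightOneSpectrum (NumberField.RingOfIntegers K), ((ℓ : ℕ) : NumberField.RingOfIntegers K) ∉ w.asIdeal → ρ.IsUnramifiedAt w) → (∀ (d' n' : ℕ), (n' < n ∨ (n' = n ∧ d' < Module.finrank ℚ K)) → ∀ (K' : Type) [Field K'] [NumberField K'], Module.finrank ℚ K' = d' → 0 < n' → ∀ (ℓ' : ℕ) [Fact ℓ'.Prime], ℓ' ≠ 2 → ∀ (ι' : PadicAlgCl ℓ' ≃+* ℂ) (σ : Literature.NumberTheory.GaloisRepresentations.FramedGaloisRep K' (PadicAlgCl ℓ') n'), σ.toGaloisRep.IsIrreducible →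 (∀ (L : Type) [Field L] [NumberField L] [Algebra K' L], (σ.restrictField L).toGaloisRep.IsIrreducible) → ((∀ᶠ v : IsDedekindDomain.HeightOneSpectrum (NumberField.RingOfIntegers K') in cofinite, σ.IsUnramifiedAt v) ∧ ∀ (v : IsDedekindDomain.HeightOneSpectrum (NumberField.RingOfIntegers K')) (hv : ((ℓ' : ℕ) : NumberField.RingOfIntegers K') ∈ v.asIdeal), (Literature.NumberTheory.PAdicHodge.fontainePstAdicCompletion v ℓ' hv).IsDeRhamFramed (σ.toLocal v)) → (∀ (v : IsDedekindDomain.HeightOneSpectrum (NumberField.RingOfIntegers K')) (hv : ((ℓ' : ℕ) : NumberField.RingOfIntegers K') ∈ v.asIdeal), (Literature.NumberTheory.PAdicHodge.fontainePstAdicCompletion v ℓ' hv).IsCrystallineFramed (σ.toLocal v)) → (∀ w : IsDedekindDomain.HeightOneSpectrum (NumberField.RingOfIntegers K'), ((ℓ' : ℕ) : NumberField.RingOfIntegers K') ∉ w.asIdeal → σ.IsUnramifiedAt w) → ∀ (ι₂' : PadicAlgCl 2 ≃+* ℂ), ∃ σ₂ : Literature.NumberTheory.GaloisRepresentations.FramedGaloisRep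 K' (PadicAlgCl 2) n', (∀ᶠ v : IsDedekindDomain.HeightOneSpectrum (NumberField.RingOfIntegers K') in cofinite, σ₂.IsUnramifiedAt v) ∧ (∀ᶠ v : IsDedekindDomain.HeightOneSpectrum (NumberField.RingOfIntegers K') in cofinite, ∃ α : Multiset ℂ, σ.HasFrobCharpolyAt v (Literature.NumberTheory.Automorphic.arithFrobPolyOfSatake ι' v.residueCard 1 α) ∧ σ₂.HasFrobCharpolyAt v (Literature.NumberTheory.Automorphic.arithFrobPolyOfSatake ι₂' v.residueCard 1 α))) → ¬ (∃ (a b : ℕ) (σ₁ : Literature.NumberTheory.GaloisRepresentations.FramedGaloisRep K (PadicAlgCl ℓ) a) (σ₂ : Literature.NumberTheory.GaloisRepresentations.FramedGaloisRep K (PadicAlgCl ℓ) b), 2 ≤ a ∧ 2 ≤ b ∧ n = a * b ∧ (σ₁.toGaloisRep.IsIrreducible ∧ (∀ (L : Type) [Field L] [NumberField L] [Algebra K L], (σ₁.restrictField L).toGaloisRep.IsIrreducible) ∧ ((∀ᶠ v : IsDedekindDomain.HeightOneSpectrum (NumberField.RingOfIntegers K) in cofinite, σ₁.IsUnramifiedAt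 v) ∧ ∀ (v : IsDedekindDomain.HeightOneSpectrum (NumberField.RingOfIntegers K)) (hv : ((ℓ : ℕ) : NumberField.RingOfIntegers K) ∈ v.asIdeal), (Literature.NumberTheory.PAdicHodge.fontainePstAdicCompletion v ℓ hv).IsDeRhamFramed (σ₁.toLocal v)) ∧ (∀ (v : IsDedekindDomain.HeightOneSpectrum (NumberField.RingOfIntegers K)) (hv : ((ℓ : ℕ) : NumberField.RingOfIntegers K) ∈ v.asIdeal), (Literature.NumberTheory.PAdicHodge.fontainePstAdicCompletion v ℓ hv).IsCrystallineFramed (σ₁.toLocal v)) ∧ (∀ w : IsDedekindDomain.HeightOneSpectrum (NumberField.RingOfIntegers K), ((ℓ : ℕ) : NumberField.RingOfIntegers K) ∉ w.asIdeal → σ₁.IsUnramifiedAt w)) ∧ (σ₂.toGaloisRep.IsIrreducible ∧ (∀ (L : Type) [Field L] [NumberField L] [Algebra K L], (σ₂.restrictField L).toGaloisRep.IsIrreducible) ∧ ((∀ᶠ v : IsDedekindDomain.HeightOneSpectrum (NumberField.RingOfIntegers K) in cofinite, σ₂.IsUnramifiedAt v) ∧ ∀ (v : IsDedekindDomain.HeightOneSpectrum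 (NumberField.RingOfIntegers K)) (hv : ((ℓ : ℕ) : NumberField.RingOfIntegers K) ∈ v.asIdeal), (Literature.NumberTheory.PAdicHodge.fontainePstAdicCompletion v ℓ hv).IsDeRhamFramed (σ₂.toLocal v)) ∧ (∀ (v : IsDedekindDomain.HeightOneSpectrum (NumberField.RingOfIntegers K)) (hv : ((ℓ : ℕ) : NumberField.RingOfIntegers K) ∈ v.asIdeal), (Literature.NumberTheory.PAdicHodge.fontainePstAdicCompletion v ℓ hv).IsCrystallineFramed (σ₂.toLocal v)) ∧ (∀ w : IsDedekindDomain.HeightOneSpectrum (NumberField.RingOfIntegers K), ((ℓ : ℕ) : NumberField.RingOfIntegers K) ∉ w.asIdeal → σ₂.IsUnramifiedAt w)) ∧ ∀ g : Field.absoluteGaloisGroup K, Literature.NumberTheory.GaloisRepresentations.FramedRep.charpoly ρ g = (Matrix.kroneckerMap (· * ·) ((σ₁ g : GL (Fin a) (PadicAlgCl ℓ)) : Matrix (Fin a) (Fin a) (PadicAlgCl ℓ)) ((σ₂ g : GL (Fin b) (PadicAlgCl ℓ)) : Matrix (Fin b) (Fin b) (PadicAlgCl ℓ))).charpoly) → ¬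 (2 ≤ n ∧ ∃ χ : Literature.NumberTheory.GaloisRepresentations.FramedGaloisRep K (PadicAlgCl ℓ) 1, (χ.toGaloisRep.IsIrreducible ∧ (∀ (L : Type) [Field L] [NumberField L] [Algebra K L], (χ.restrictField L).toGaloisRep.IsIrreducible) ∧ ((∀ᶠ v : IsDedekindDomain.HeightOneSpectrum (NumberField.RingOfIntegers K) in cofinite, χ.IsUnramifiedAt v) ∧ ∀ (v : IsDedekindDomain.HeightOneSpectrum (NumberField.RingOfIntegers K)) (hv : ((ℓ : ℕ) : NumberField.RingOfIntegers K) ∈ v.asIdeal), (Literature.NumberTheory.PAdicHodge.fontainePstAdicCompletion v ℓ hv).IsDeRhamFramed (χ.toLocal v)) ∧ (∀ (v : IsDedekindDomain.HeightOneSpectrum (NumberField.RingOfIntegers K)) (hv : ((ℓ : ℕ) : NumberField.RingOfIntegers K) ∈ v.asIdeal), (Literature.NumberTheory.PAdicHodge.fontainePstAdicCompletion v ℓ hv).IsCrystallineFramed (χ.toLocal v)) ∧ (∀ w : IsDedekindDomain.HeightOneSpectrum (NumberField.RingOfIntegers K), ((ℓ : ℕ) : NumberField.RingOfIntegers K) ∉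 w.asIdeal → χ.IsUnramifiedAt w)) ∧ ∃ (K₀ : Type) (_ : Field K₀) (_ : NumberField K₀) (_ : Algebra K₀ K) (ρ₀ : Literature.NumberTheory.GaloisRepresentations.FramedGaloisRep K₀ (PadicAlgCl ℓ) n), Module.finrank ℚ K₀ < Module.finrank ℚ K ∧ (ρ₀.toGaloisRep.IsIrreducible ∧ (∀ (L : Type) [Field L] [NumberField L] [Algebra K₀ L], (ρ₀.restrictField L).toGaloisRep.IsIrreducible) ∧ ((∀ᶠ v : IsDedekindDomain.HeightOneSpectrum (NumberField.RingOfIntegers K₀) in cofinite, ρ₀.IsUnramifiedAt v) ∧ ∀ (v : IsDedekindDomain.HeightOneSpectrum (NumberField.RingOfIntegers K₀)) (hv : ((ℓ : ℕ) : NumberField.RingOfIntegers K₀) ∈ v.asIdeal), (Literature.NumberTheory.PAdicHodge.fontainePstAdicCompletion v ℓ hv).IsDeRhamFramed (ρ₀.toLocal v)) ∧ (∀ (v : IsDedekindDomain.HeightOneSpectrum (NumberField.RingOfIntegers K₀)) (hv : ((ℓ : ℕ) : NumberField.RingOfIntegers K₀) ∈ v.asIdeal), (Literature.NumberTheory.PAdicHodge.fontainePstAdicCompletion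 v ℓ hv).IsCrystallineFramed (ρ₀.toLocal v)) ∧ (∀ w : IsDedekindDomain.HeightOneSpectrum (NumberField.RingOfIntegers K₀), ((ℓ : ℕ) : NumberField.RingOfIntegers K₀) ∉ w.asIdeal → ρ₀.IsUnramifiedAt w)) ∧ ∀ g : Field.absoluteGaloisGroup K, Literature.NumberTheory.GaloisRepresentations.FramedRep.charpoly ρ g = (Matrix.kroneckerMap (· * ·) (((ρ₀.restrictField K) g : GL (Fin n) (PadicAlgCl ℓ)) : Matrix (Fin n) (Fin n) (PadicAlgCl ℓ)) ((χ g : GL (Fin 1) (PadicAlgCl ℓ)) : Matrix (Fin 1) (Fin 1) (PadicAlgCl ℓ))).charpoly) → ∀ (ι₂ : PadicAlgCl 2 ≃+* ℂ), ∃ ρ₂ : Literature.NumberTheory.GaloisRepresentations.FramedGaloisRep K (PadicAlgCl 2) n, (∀ᶠ v : IsDedekindDomain.HeightOneSpectrum (NumberField.RingOfIntegers K) in cofinite, ρ₂.IsUnramifiedAt v) ∧ (∀ᶠ v : IsDedekindDomain.HeightOneSpectrum (NumberField.RingOfIntegers K) in cofinite, ∃ α : Multiset ℂ, ρ.HasFrobCharpolyAt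 v (Literature.NumberTheory.Automorphic.arithFrobPolyOfSatake ι v.residueCard 1 α) ∧ ρ₂.HasFrobCharpolyAt v (Literature.NumberTheory.Automorphic.arithFrobPolyOfSatake ι₂ v.residueCard 1 α))

end Pieces

/-! ## Bridges (`Iff.rfl`: the one-line texts ARE the vocabulary forms) -/

section Bridges

/-- TP unfolded: the filed text IS the vocabulary form (`Iff.rfl`). -/
theorem kroneckerCompanionCell_iff : KroneckerCompanionCell ↔
    (∀ (K : Type) [Field K] [NumberField K] (n : ℕ), 0 < n → ∀ (ℓ : ℕ) [Fact ℓ.Prime], ℓ ≠ 2 →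
      ∀ (ι : PadicAlgCl ℓ ≃+* ℂ) (ρ : FramedGaloisRep K (PadicAlgCl ℓ) n), ρ.toGaloisRep.IsIrreducible →
        IsLieIrreducible ρ → IsPinnedGeometric ρ → IsCrystallineAbove ρ → IsUnramifiedAwayFrom ρ →
          LieSliceBelow K n → IsKroneckerOfLevelOne ρ → ∀ (ι₂ : PadicAlgCl 2 ≃+* ℂ), HasDyadicCompanion ι ι₂ ρ) :=
  Iff.rfl

/-- FD unfolded: the filed text IS the vocabulary form (`Iff.rfl`). -/
theorem baseChangedCompanionCell_iff : BaseChangedCompanionCell ↔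
    (∀ (K : Type) [Field K] [NumberField K] (n : ℕ), 0 < n → ∀ (ℓ : ℕ) [Fact ℓ.Prime], ℓ ≠ 2 →
      ∀ (ι : PadicAlgCl ℓ ≃+* ℂ) (ρ : FramedGaloisRep K (PadicAlgCl ℓ) n), ρ.toGaloisRep.IsIrreducible →
        IsLieIrreducible ρ → IsPinnedGeometric ρ → IsCrystallineAbove ρ → IsUnramifiedAwayFrom ρ →
          LieSliceBelow K n → IsTwistedBaseChangedOfLevelOne ρ → ∀ (ι₂ : PadicAlgCl 2 ≃+* ℂ), HasDyadicCompanion ι ι₂ ρ) :=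
  Iff.rfl

/-- PR′ unfolded: the filed text IS the vocabulary form (`Iff.rfl`). -/
theorem primitiveCompanionCore_iff : PrimitiveCompanionCore ↔
    (∀ (K : Type) [Field K] [NumberField K] (n : ℕ), 0 < n → ∀ (ℓ : ℕ) [Fact ℓ.Prime], ℓ ≠ 2 →
      ∀ (ι : PadicAlgCl ℓ ≃+* ℂ) (ρ : FramedGaloisRep K (PadicAlgCl ℓ) n), ρ.toGaloisRep.IsIrreducible →
        IsLieIrreducible ρ → IsPinnedGeometric ρ → IsCrystallineAbove ρ → IsUnramifiedAwayFrom ρ →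
          LieSliceBelow K n → ¬ IsKroneckerOfLevelOne ρ → ¬ IsTwistedBaseChangedOfLevelOne ρ →
            ∀ (ι₂ : PadicAlgCl 2 ≃+* ℂ), HasDyadicCompanion ι ι₂ ρ) :=
  Iff.rfl

/-- The slice at `(d, n)` is R restricted to `[K:ℚ] = d` (by `Iff.rfl` up to the order of the two numeric hypotheses). -/
theorem lieSlice_of_R (hR : LieIrreducibleCompanion) (d n : ℕ) : LieSlice d n := by
  rw [lieIrreducibleCompanion_iff] at hR
  intro K _ _ _hd hn ℓ _ hℓ ι σ hirr hLie hgeo hcrys hlvl ι₂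
  exact hR K n hn ℓ hℓ ι σ hirr hLie hgeo hcrys hlvl ι₂

/-- Conversely R is the conjunction of its slices. -/
theorem lieIrreducibleCompanion_of_slices (h : ∀ n d, LieSlice d n) : LieIrreducibleCompanion := by
  rw [lieIrreducibleCompanion_iff]
  intro K _ _ n hn ℓ _ hℓ ι ρ hirr hLie hgeo hcrys hlvl ι₂
  exact h n (Module.finrank ℚ K) K rfl hn ℓ hℓ ι ρ hirr hLie hgeo hcrys hlvl ι₂

/-- R gives the induction hypothesis below any (n, [K:ℚ]). -/
theorem lieSliceBelow_of_R (hR : LieIrreducibleCompanion) (K : Type) [Field K] [NumberField K] (n : ℕ) : LieSliceBelow K n :=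
  fun d' n' _ => lieSlice_of_R hR d' n'

end Bridges

/-! ## KERNEL I — necessity: each piece is implied outright by R (forget the IH and the dial), hence by T, E and `Langlands` -/

section Necessity

/-- **R ⟹ TP**. -/
theorem kroneckerCompanionCell_of_R (hR : LieIrreducibleCompanion) : KroneckerCompanionCell := by
  rw [lieIrreducibleCompanion_iff] at hR
  rw [kroneckerCompanionCell_iff]
  intro K _ _ n hn ℓ _ hℓ ι ρ hirr hLie hgeo hcrys hlvl _ _ ι₂
  exact hR K n hn ℓ hℓ ι ρ hirr hLie hgeo hcrys hlvl ι₂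

/-- **R ⟹ FD**. -/
theorem baseChangedCompanionCell_of_R (hR : LieIrreducibleCompanion) : BaseChangedCompanionCell := by
  rw [lieIrreducibleCompanion_iff] at hR
  rw [baseChangedCompanionCell_iff]
  intro K _ _ n hn ℓ _ hℓ ι ρ hirr hLie hgeo hcrys hlvl _ _ ι₂
  exact hR K n hn ℓ hℓ ι ρ hirr hLie hgeo hcrys hlvl ι₂

/-- **R ⟹ PR**. -/
theorem primitiveCompanionCore_of_R (hR : LieIrreducibleCompanion) : PrimitiveCompanionCore := by
  rw [lieIrreducibleCompanion_iff] at hR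
  rw [primitiveCompanionCore_iff]
  intro K _ _ n hn ℓ _ hℓ ι ρ hirr hLie hgeo hcrys hlvl _ _ _ ι₂
  exact hR K n hn ℓ hℓ ι ρ hirr hLie hgeo hcrys hlvl ι₂

/-- T ⟹ TP. -/
theorem kroneckerCompanionCell_of_T (hT : DyadicContinuousCompanion) : KroneckerCompanionCell :=
  kroneckerCompanionCell_of_R (lieIrreducibleCompanion_of_T hT)
/-- T ⟹ FD. -/
theorem baseChangedCompanionCell_of_T (hT : DyadicContinuousCompanion) : BaseChangedCompanionCell :=
  baseChangedCompanionCell_of_R (lieIrreducibleCompanion_of_T hT)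
/-- T ⟹ PR′. -/
theorem primitiveCompanionCore_of_T (hT : DyadicContinuousCompanion) : PrimitiveCompanionCore :=
  primitiveCompanionCore_of_R (lieIrreducibleCompanion_of_T hT)

/-- E ⟹ TP. -/
theorem kroneckerCompanionCell_of_E (hE : DyadicCompanionExistence) : KroneckerCompanionCell :=
  kroneckerCompanionCell_of_R (lieIrreducibleCompanion_of_E hE)
/-- E ⟹ FD. -/
theorem baseChangedCompanionCell_of_E (hE : DyadicCompanionExistence) : BaseChangedCompanionCell :=
  baseChangedCompanionCell_of_R (lieIrreducibleCompanion_of_E hE)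
/-- E ⟹ PR′. -/
theorem primitiveCompanionCore_of_E (hE : DyadicCompanionExistence) : PrimitiveCompanionCore :=
  primitiveCompanionCore_of_R (lieIrreducibleCompanion_of_E hE)

/-- **Langlands ⟹ TP / FD / PR** (necessity relative to the summit: each piece is a consequence of S used toward S). -/
theorem kroneckerCompanionCell_of_langlands (hLg : _root_.Langlands) : KroneckerCompanionCell :=
  kroneckerCompanionCell_of_R (lieIrreducibleCompanion_of_langlands hLg)
/-- Necessity: `Langlands` ⟹ FD. -/
theorem baseChangedCompanionCell_of_langlands (hLg : _root_.Langlands) : BaseChangedCompanionCell :=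
  baseChangedCompanionCell_of_R (lieIrreducibleCompanion_of_langlands hLg)
/-- Necessity: `Langlands` ⟹ PR′. -/
theorem primitiveCompanionCore_of_langlands (hLg : _root_.Langlands) : PrimitiveCompanionCore :=
  primitiveCompanionCore_of_R (lieIrreducibleCompanion_of_langlands hLg)

end Necessity

/-! ## KERNEL II — exactness: R ⟸ TP ∧ FD ∧ PR by ONE lexicographic strong induction on (n, [K:ℚ]); R ⟺ TP ∧ FD ∧ PR modulo nothing -/

section Exactness

/-- **Every slice of R from the three cells**: strong induction on the dimension `n`, and inside it strong induction on the absolute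
degree `d = [K:ℚ]`; at `(n, d)` the carried IH `LieSliceBelow K n` is exactly what the two inductions provide, and the three cells are the
three cases Kronecker / twisted-base-changed / primitive. -/
theorem lieSlice_of_primitive (hTP : KroneckerCompanionCell) (hFD : BaseChangedCompanionCell) (hPR : PrimitiveCompanionCore) :
    ∀ n d, LieSlice d n := by
  rw [kroneckerCompanionCell_iff] at hTP
  rw [baseChangedCompanionCell_iff] at hFD
  rw [primitiveCompanionCore_iff] at hPR
  intro n
  induction n using Nat.strong_induction_on with
  | _ n ihn =>
    intro d
    induction d using Nat.strong_induction_on with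
    | _ d ihd =>
      intro K _ _ hd hn ℓ _ hℓ ι ρ hirr hLie hgeo hcrys hlvl ι₂
      have IH : LieSliceBelow K n := by
        rintro d' n' (h | ⟨rfl, h⟩)
        · exact ihn n' h d'
        · exact ihd d' (h.trans_eq hd)
      by_cases hK : IsKroneckerOfLevelOne ρ
      · exact hTP K n hn ℓ hℓ ι ρ hirr hLie hgeo hcrys hlvl IH hK ι₂
      · by_cases hB : IsTwistedBaseChangedOfLevelOne ρ
        · exact hFD K n hn ℓ hℓ ι ρ hirr hLie hgeo hcrys hlvl IH hB ι₂
        · exact hPR K n hn ℓ hℓ ι ρ hirr hLie hgeo hcrys hlvl IH hK hB ι₂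

/-- **R ⟸ TP ∧ FD ∧ PR**. -/
theorem lieIrreducibleCompanion_of_primitive (hTP : KroneckerCompanionCell) (hFD : BaseChangedCompanionCell)
    (hPR : PrimitiveCompanionCore) : LieIrreducibleCompanion :=
  lieIrreducibleCompanion_of_slices (lieSlice_of_primitive hTP hFD hPR)

/-- **R ⟺ TP ∧ FD ∧ PR** — the cut is EXACT modulo nothing. -/
theorem lieIrreducibleCompanion_iff_primitive :
    LieIrreducibleCompanion ↔ (KroneckerCompanionCell ∧ BaseChangedCompanionCell ∧ PrimitiveCompanionCore) :=
  ⟨fun hR => ⟨kroneckerCompanionCell_of_R hR, baseChangedCompanionCell_of_R hR, primitiveCompanionCore_of_R hR⟩,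
    fun h => lieIrreducibleCompanion_of_primitive h.1 h.2.1 h.2.2⟩

/-- **PR ⟺ R modulo the two PROVABLE cells**: once TP and FD land, «the minimal counterexample to R is primitive» is a theorem. -/
theorem primitiveCompanionCore_iff_R (hTP : KroneckerCompanionCell) (hFD : BaseChangedCompanionCell) :
    PrimitiveCompanionCore ↔ LieIrreducibleCompanion :=
  ⟨fun hPR => lieIrreducibleCompanion_of_primitive hTP hFD hPR, primitiveCompanionCore_of_R⟩

/-- **PC ⟸ TP ∧ FD ∧ PR** — the node also decomposes the residual of record PC = stmt-Langlands-33717 of the child route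
(through R, `Potential.potentialCompanions_of_R`); the converse PC ⟹ R needs the child route's BT, HER, G, I. -/
theorem potentialCompanions_of_primitive (hTP : KroneckerCompanionCell) (hFD : BaseChangedCompanionCell)
    (hPR : PrimitiveCompanionCore) : PotentialCompanions :=
  potentialCompanions_of_R (lieIrreducibleCompanion_of_primitive hTP hFD hPR)

/-- PC ∧ BT ∧ HER ∧ G ∧ I ⟹ TP ∧ FD ∧ PR (so on the child route the three cells and PC carry the same open content modulo its items). -/
theorem primitive_of_potential (hPC : PotentialCompanions) (hBT : BrauerTaylorDescent) (hH : LevelOneHeredity)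
    (hG : DyadicDeRhamRigidity) (hI : DyadicIrreducibilityTransfer) :
    KroneckerCompanionCell ∧ BaseChangedCompanionCell ∧ PrimitiveCompanionCore :=
  lieIrreducibleCompanion_iff_primitive.1 (lieIrreducibleCompanion_of_pieces' hPC hBT hH hG hI)

/-- **T ⟸ TP ∧ FD ∧ PR ∧ D′** (through part 5). -/
theorem dyadicContinuousCompanion_of_pieces₁₃ (hTP : KroneckerCompanionCell) (hFD : BaseChangedCompanionCell)
    (hPR : PrimitiveCompanionCore) (hS : CliffordCompanionStep) : DyadicContinuousCompanion :=
  dyadicContinuousCompanion_of_pieces (lieIrreducibleCompanion_of_primitive hTP hFD hPR) hS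

/-- **E ⟸ TP FD PR + G TF C♯** (k = 4β shape of route-Langlands-DyadicCompanionSplit rev 3, through part 6b). -/
theorem dyadicCompanionExistence_of_resplit4β₁₃ (hTP : KroneckerCompanionCell) (hFD : BaseChangedCompanionCell)
    (hPR : PrimitiveCompanionCore) (hG : DyadicDeRhamRigidity) (hT : ArtinTensorCore) (hC : CliffordTateShapes) :
    DyadicCompanionExistence :=
  dyadicCompanionExistence_of_resplit4β (lieIrreducibleCompanion_of_primitive hTP hFD hPR) hG hT hC

end Exactness

/-! ## KERNEL III — the pieces + the lineage frame ⟹ `_root_.Langlands` -/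

section Closes

open Summit.Langlands.Langlands.Theses

/-- **TP FD PR + FRAME ⟹ Langlands**: the `closes` shape of a child route refining item 33380 (FRAME = item stmt-Langlands-33720,
`LieIrreducibleCompanion → Langlands`, stated here on the tree decl with the identical text). -/
theorem langlands_of_primitive_frame (hTP : KroneckerCompanionCell) (hFD : BaseChangedCompanionCell) (hPR : PrimitiveCompanionCore)
    (hF : LieIrreducibleCompanion → _root_.Langlands) : _root_.Langlands :=
  hF (lieIrreducibleCompanion_of_primitive hTP hFD hPR)

/-- **TP FD PR D′ + G I U + the MinimalLevelDescent frame ⟹ Langlands** (sixteen binders, through part 5's `langlands_of_pieces₉`). -/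
theorem langlands_of_pieces₁₃ (hTP : KroneckerCompanionCell) (hFD : BaseChangedCompanionCell) (hPR : PrimitiveCompanionCore)
    (hS : CliffordCompanionStep) (hG : DyadicDeRhamRigidity) (hI : DyadicIrreducibilityTransfer) (hU : DyadicLevelTransfer)
    (hK : ResidualInertiaDescent) (hWM : MinimalLevelDescent.WeightMove) (hLM : MinimalLevelDescent.LevelMove)
    (hB : MinimalLevelDescent.DyadicLevelOneAutomorphy) (hL : MinimalLevelDescent.AutomorphyLifting)
    (hW : MinimalLevelDescent.SatakeAvatarExistence) (hP : MinimalLevelDescent.PadicMemberCompatibility)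
    (hA : MinimalLevelDescent.CompatibilityAwayFromLR) (hCRD : MinimalLevelDescent.CanonicalReciprocityData) :
    _root_.Langlands :=
  langlands_of_pieces₉ (lieIrreducibleCompanion_of_primitive hTP hFD hPR) hS hG hI hU hK hWM hLM hB hL hW hP hA hCRD

/-- k = 4β: **TP FD PR + C♯ TF + G I U + frame ⟹ Langlands** (seventeen binders, through part 6b's `langlands_of_pieces₁₀β`). -/
theorem langlands_of_pieces₁₃β (hTP : KroneckerCompanionCell) (hFD : BaseChangedCompanionCell) (hPR : PrimitiveCompanionCore)
    (hC : CliffordTateShapes) (hT : ArtinTensorCore) (hG : DyadicDeRhamRigidity) (hI : DyadicIrreducibilityTransfer)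
    (hU : DyadicLevelTransfer) (hK : ResidualInertiaDescent) (hWM : MinimalLevelDescent.WeightMove)
    (hLM : MinimalLevelDescent.LevelMove) (hB : MinimalLevelDescent.DyadicLevelOneAutomorphy)
    (hL : MinimalLevelDescent.AutomorphyLifting) (hW : MinimalLevelDescent.SatakeAvatarExistence)
    (hP : MinimalLevelDescent.PadicMemberCompatibility) (hA : MinimalLevelDescent.CompatibilityAwayFromLR)
    (hCRD : MinimalLevelDescent.CanonicalReciprocityData) : _root_.Langlands :=
  langlands_of_pieces₁₀β (lieIrreducibleCompanion_of_primitive hTP hFD hPR) hC hT hG hI hU hK hWM hLM hB hL hW hP hA hCRD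

/-- `closes` — the node's deciding composition to the summit BY NAME (= `langlands_of_pieces₁₃`). -/
theorem closes (hTP : KroneckerCompanionCell) (hFD : BaseChangedCompanionCell) (hPR : PrimitiveCompanionCore)
    (hS : CliffordCompanionStep) (hG : DyadicDeRhamRigidity) (hI : DyadicIrreducibilityTransfer) (hU : DyadicLevelTransfer)
    (hK : ResidualInertiaDescent) (hWM : MinimalLevelDescent.WeightMove) (hLM : MinimalLevelDescent.LevelMove)
    (hB : MinimalLevelDescent.DyadicLevelOneAutomorphy) (hL : MinimalLevelDescent.AutomorphyLifting)
    (hW : MinimalLevelDescent.SatakeAvatarExistence) (hP : MinimalLevelDescent.PadicMemberCompatibility)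
    (hA : MinimalLevelDescent.CompatibilityAwayFromLR) (hCRD : MinimalLevelDescent.CanonicalReciprocityData) :
    _root_.Langlands :=
  langlands_of_pieces₁₃ hTP hFD hPR hS hG hI hU hK hWM hLM hB hL hW hP hA hCRD

end Closes

end Summit.Langlands.Langlands.Theorems.LevelOneDyadic.Primitive
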